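import Summits.QuantumAdvantage.QuantumAdvantage.Theorems.SosSandwichPseudoBoundedTopPairingContraction
import HarnessLib

/-!
# Crux `PseudoBoundedAA` (stmt-QuantumAdvantage-15237) / item `HomogeneousPBAAT` (stmt-27399): the uniform
# contraction bound forces top-level AA for EVERY bounded polynomial — padded (idle variables supplied)

Companion of `Theorems/SosSandwichPseudoBoundedTopPairingContraction.lean`.  There,
`TopPairing.topWeight_sq_le_rowWeight_of_uniformContraction`: under the UNIFORM CONTRACTION BOUND with constant
`K(T)` (the inline hypothesis of `TopPairing.homogeneousPBAAT_of_contractionBound`, the candidate replacement line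
for the dead stub `stub_homogeneousRung` of `Cruxes/PseudoBoundedAA/Lines/birth.lean`), every cube-bounded `g` of
degree `≤ T` that already HAS enough idle variables satisfies `(W^{=T}[g])² ≤ K(T)·max_k Σ_{|S|=T, S∋k} ĝ(S)²`.
Here the idle variables are SUPPLIED: `g ↦ rename (Fin.natAdd n₁) g` pads `g` with `n₁` fresh coordinates, which
changes no Walsh coefficient (§1: `cubeFourierCoeff_pad_map`, `cubeFourierCoeff_pad_eq_zero`, and the re-indexing
`sum_pad_eq` of sums over subsets of the padded cube), so that (§2)

* `exists_topRow_ge_of_uniformContraction` — **for EVERY `g` of total degree `≤ T` (`T ≥ 1`) with `g² ≤ 1` on the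
  cube and `W^{=T}[g] > 0`: `∃ k, (W^{=T}[g])² ≤ K(T) · Σ_{|S|=T, S∋k} ĝ(S)²`**;
* `exists_influence_ge_topWeight_sq_of_uniformContraction` — hence `∃ k, 4·(W^{=T}[g])² ≤ K(T)·Inf_k[g]`
  (`Inf_k = 4 Σ_{S∋k} ĝ(S)²`): top-level Aaronson–Ambainis with constant `K(T)` for ALL bounded polynomials — for
  homogeneous `g` (`Var = W^{=T}`), in particular block-multilinear (fully decoupled) forms, the AA conjecture on that
  class: an OPEN case of `AAConjecture` (known only under complete boundedness, Bansal–Sinha–de Wolf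
  arXiv:2203.00212 / Escudero Gutiérrez Thm 1.6) that already implies AA14's Quantum Conjecture
  (`QuantumQuerySimulable`) by Aaronson–Ambainis 2015, as recorded in O'Donnell–Zhao arXiv:1512.01603 Remark 2.14
  (their Thm 2.13 is AA ⟺ AA for ONE-block decoupled `f`).  The crux `PseudoBoundedAA` is WEAKER than
  `AAConjecture` (`AAConjImpliesPBAA`).  Planner verdict: a polynomial uniform contraction constant is at least
  block-multilinear-AA-hard and would give the route's analytic goal directly — no shortcut for 15237/27399.

Honest label: calibration of a proposed line; proves neither 27399 nor the crux; no registered stub is closed.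
Finite sums only; no named facts.  Sources: EscuderoGutierrez2023 (arXiv:2304.06713) Question 4.5;
ODonnellZhao2016 (arXiv:1512.01603) Thm 2.13 / Remark 2.14; BansalSinhaDeWolf2022 (arXiv:2203.00212);
AaronsonAmbainis2014 Conj. 6; ODonnell2014 §2.2.
-/

set_option linter.dupNamespace false

noncomputable section

namespace Summit.QuantumAdvantage.QuantumAdvantage.Theorems.SosSandwich

open Finset MvPolynomial Literature.Computability.QuantumComplexity
open Literature.Computability.Complexity.LowDegree Literature.Probability.RandomGraphs.LowDegree

namespace TopPairing

variable {N n₁ : ℕ}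

/-! ### §1 Padding with idle variables does not change Walsh coefficients -/

/-- Characters of sets embedded by `Fin.natAddEmb n₁ : Fin N ↪ Fin (n₁ + N)` (`j ↦ n₁ + j`) are the
characters on the live block. [folklore] -/
theorem walsh_map_natAdd (S : Finset (Fin N)) (z : Fin (n₁ + N) → Bool) :
    walsh (S.map (Fin.natAddEmb n₁)) z = walsh S (z ∘ Fin.natAdd n₁) := by
  unfold walsh
  rw [Finset.prod_map]
  rfl

/-- **Padding preserves the Walsh coefficients of the live block**:
`(rename natAdd g)^(S.map natAdd) = ĝ(S)`. [cite: ODonnell2014, §1.4] -/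
theorem cubeFourierCoeff_pad_map (g : MvPolynomial (Fin N) ℝ) (S : Finset (Fin N)) :
    cubeFourierCoeff (evalBool (rename (Fin.natAdd n₁) g)) (S.map (Fin.natAddEmb n₁)) =
      cubeFourierCoeff (evalBool g) S := by
  show boolAvg (fun z : Fin (n₁ + N) → Bool => evalBool (rename (Fin.natAdd n₁) g) z *
      walsh (S.map (Fin.natAddEmb n₁)) z) =
    boolAvg (fun y : Fin N → Bool => evalBool g y * walsh S y)
  simp_rw [evalBool_rename_natAdd, walsh_map_natAdd]
  exact AddrWitness.boolAvg_comp_natAdd (N₁ := n₁) (fun y => evalBool g y * walsh S y)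

/-- **Padding coordinates are idle**: a Walsh coefficient of the padded polynomial at a set containing a padding
coordinate vanishes. [cite: ODonnell2014, §2.2] -/
theorem cubeFourierCoeff_pad_eq_zero (g : MvPolynomial (Fin N) ℝ) {S' : Finset (Fin (n₁ + N))} {i : Fin n₁}
    (hi : Fin.castAdd N i ∈ S') : cubeFourierCoeff (evalBool (rename (Fin.natAdd n₁) g)) S' = 0 :=
  cubeFourierCoeff_eq_zero_of_flipBit
    (fun z => by rw [evalBool_rename_natAdd, evalBool_rename_natAdd, flipBit_castAdd_comp_natAdd]) hi

/-- Every coordinate of `Fin (n₁ + N)` is a padding coordinate `castAdd i` or a live one `natAdd j`. [folklore] -/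
theorem castAdd_or_natAdd (z : Fin (n₁ + N)) :
    (∃ i : Fin n₁, z = Fin.castAdd N i) ∨ (∃ j : Fin N, z = Fin.natAdd n₁ j) := by
  obtain ⟨x, rfl⟩ := finSumFinEquiv.surjective z
  rcases x with i | j
  · exact Or.inl ⟨i, finSumFinEquiv_apply_left i⟩
  · exact Or.inr ⟨j, finSumFinEquiv_apply_right j⟩

/-- **Re-indexing sums over subsets of the padded cube**: a function of subsets vanishing on every set that
contains a padding coordinate is summed over the embedded subsets of the live block only. [folklore] -/
theorem sum_pad_eq (F : Finset (Fin (n₁ + N)) → ℝ)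
    (hF : ∀ (S' : Finset (Fin (n₁ + N))) (i : Fin n₁), Fin.castAdd N i ∈ S' → F S' = 0)
    (P : Finset (Fin (n₁ + N)) → Prop) [DecidablePred P] :
    ∑ S' ∈ Finset.univ.filter P, F S' =
      ∑ S ∈ Finset.univ.filter (fun S : Finset (Fin N) => P (S.map (Fin.natAddEmb n₁))),
        F (S.map (Fin.natAddEmb n₁)) := by
  classical
  set e : Fin N ↪ Fin (n₁ + N) := Fin.natAddEmb n₁ with he
  have hinj : Function.Injective (fun S : Finset (Fin N) => S.map e) := fun S S' h => Finset.map_injective e h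
  rw [← Finset.sum_image (f := F) (fun S _ S' _ h => hinj h)]
  symm
  refine Finset.sum_subset ?_ ?_
  · intro S' hS'
    rw [Finset.mem_image] at hS'
    obtain ⟨S, hS, rfl⟩ := hS'
    rw [Finset.mem_filter] at hS ⊢
    exact ⟨Finset.mem_univ _, hS.2⟩
  · intro S' hS' hS'im
    by_contra hne
    -- `F S' ≠ 0` ⟹ no padding coordinate in `S'` ⟹ `S'` is an embedded live subset
    have hno : ∀ i : Fin n₁, Fin.castAdd N i ∉ S' := fun i hi => hne (hF S' i hi)
    have hrepr : (Finset.univ.filter (fun j : Fin N => Fin.natAdd n₁ j ∈ S')).map e = S' := by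
      ext z
      rw [Finset.mem_map]
      constructor
      · rintro ⟨j, hj, rfl⟩
        rw [Finset.mem_filter] at hj
        exact hj.2
      · intro hz
        rcases castAdd_or_natAdd z with ⟨i, rfl⟩ | ⟨j, rfl⟩
        · exact absurd hz (hno i)
        · exact ⟨j, Finset.mem_filter.mpr ⟨Finset.mem_univ _, hz⟩, rfl⟩
    apply hS'im
    rw [Finset.mem_image]
    refine ⟨Finset.univ.filter (fun j : Fin N => Fin.natAdd n₁ j ∈ S'), ?_, hrepr⟩
    rw [Finset.mem_filter, hrepr]
    exact ⟨Finset.mem_univ _, (Finset.mem_filter.mp hS').2⟩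

/-! ### §2 Top-level AA for every bounded polynomial from the uniform contraction bound -/

/-- **The uniform contraction bound (constant `K T` at order `T`) gives, for EVERY polynomial `g` of total degree
`≤ T` (`T ≥ 1`) with `g² ≤ 1` on the cube and positive top weight, a variable whose top-level row weight is at
least `(W^{=T}[g])² / K(T)`**: `∃ k, (Σ_{|S|=T} ĝ(S)²)² ≤ K T · Σ_{|S|=T, S∋k} ĝ(S)²`.  Proof: pad `g` with
`n₁ ≥ T`, `n₁ ≥ T·W/μ` idle coordinates (`μ` the largest row weight) and apply
`topWeight_sq_le_rowWeight_of_uniformContraction`; §1 transports all Walsh data.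
[cite: EscuderoGutierrez2023, Question 4.5] [cite: ODonnellZhao2016, Remark 2.14] -/
theorem exists_topRow_ge_of_uniformContraction (K : ℕ → ℝ)
    (h : ∀ (N T m : ℕ) (q : Fin m → MvPolynomial (Fin N) ℝ) (p : MvPolynomial (Fin N) ℝ), 1 ≤ T →
      (∀ j, (q j).totalDegree ≤ T) → (∀ x, evalBool p x = ∑ j, evalBool (q j) x ^ 2) →
      (∀ x, evalBool p x ≤ 1) →
      ∀ (c : Finset (Fin N) → ℝ) (M : ℝ),
        (∀ k : Fin N, ∑ U ∈ Finset.univ.filter (fun U : Finset (Fin N) => U.card = 2 * T ∧ k ∈ U), c U ^ 2 ≤ M) →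
        ∑ j, ∑ R ∈ Finset.univ.filter (fun R : Finset (Fin N) => R.card = T),
          (∑ U ∈ Finset.univ.filter (fun U : Finset (Fin N) => U.card = 2 * T ∧ R ⊆ U),
            c U * cubeFourierCoeff (evalBool (q j)) (U \ R)) ^ 2 ≤ K T * M)
    {N T : ℕ} (hT : 1 ≤ T) (g : MvPolynomial (Fin N) ℝ) (hg : g.totalDegree ≤ T)
    (hg1 : ∀ x, evalBool g x ^ 2 ≤ 1)
    (hW : 0 < ∑ S ∈ Finset.univ.filter (fun S : Finset (Fin N) => S.card = T), cubeFourierCoeff (evalBool g) S ^ 2) :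
    ∃ k : Fin N, (∑ S ∈ Finset.univ.filter (fun S : Finset (Fin N) => S.card = T),
        cubeFourierCoeff (evalBool g) S ^ 2) ^ 2 ≤
      K T * ∑ S ∈ Finset.univ.filter (fun S : Finset (Fin N) => S.card = T ∧ k ∈ S),
        cubeFourierCoeff (evalBool g) S ^ 2 := by
  classical
  set a : Finset (Fin N) → ℝ := fun S => cubeFourierCoeff (evalBool g) S with ha
  set W := ∑ S ∈ Finset.univ.filter (fun S : Finset (Fin N) => S.card = T), a S ^ 2 with hWdef
  -- a nonzero top coefficient, hence a live variable `k₀`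
  obtain ⟨S₀, hS₀, hS₀ne⟩ : ∃ S ∈ Finset.univ.filter (fun S : Finset (Fin N) => S.card = T), a S ^ 2 ≠ 0 := by
    by_contra hcon
    push Not at hcon
    exact hW.ne' (Finset.sum_eq_zero hcon)
  have hS₀T : S₀.card = T := (Finset.mem_filter.mp hS₀).2
  obtain ⟨k₀, hk₀⟩ : S₀.Nonempty := by rw [← Finset.card_pos, hS₀T]; omega
  -- the largest top-level row weight `μ = row k₁ > 0`
  set row : Fin N → ℝ := fun k =>
    ∑ S ∈ Finset.univ.filter (fun S : Finset (Fin N) => S.card = T ∧ k ∈ S), a S ^ 2 with hrow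
  obtain ⟨k₁, -, hk₁⟩ := Finset.exists_max_image Finset.univ row ⟨k₀, Finset.mem_univ _⟩
  refine ⟨k₁, ?_⟩
  set μ := row k₁ with hμdef
  have hμpos : 0 < μ := by
    have h1 : a S₀ ^ 2 ≤ row k₀ :=
      Finset.single_le_sum (f := fun S => a S ^ 2) (fun S _ => sq_nonneg _)
        (Finset.mem_filter.mpr ⟨Finset.mem_univ _, hS₀T, hk₀⟩)
    have h2 : 0 < a S₀ ^ 2 := lt_of_le_of_ne (sq_nonneg _) (Ne.symm hS₀ne)
    exact lt_of_lt_of_le (lt_of_lt_of_le h2 h1) (hk₁ k₀ (Finset.mem_univ _))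
  -- the number `n₁` of idle coordinates
  obtain ⟨n₁, hn₁T, hn₁⟩ : ∃ n₁ : ℕ, T ≤ n₁ ∧ (T : ℝ) * W ≤ (n₁ : ℝ) * μ := by
    obtain ⟨n, hn⟩ := exists_nat_ge ((T : ℝ) * W / μ)
    refine ⟨n + T, by omega, ?_⟩
    rw [div_le_iff₀ hμpos] at hn
    have hT0 : (0 : ℝ) ≤ (T : ℝ) * μ := mul_nonneg (Nat.cast_nonneg T) hμpos.le
    have hexp : (((n + T : ℕ) : ℝ)) * μ = (n : ℝ) * μ + (T : ℝ) * μ := by push_cast; ring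
    rw [hexp]
    linarith
  -- the padded polynomial and its idle block
  set g' : MvPolynomial (Fin (n₁ + N)) ℝ := rename (Fin.natAdd n₁) g with hg'
  set X : Finset (Fin (n₁ + N)) :=
    (Finset.univ : Finset (Fin n₁)).map (Fin.castAddEmb N) with hXdef
  have hXcard : X.card = n₁ := by rw [hXdef, Finset.card_map, Finset.card_univ, Fintype.card_fin]
  have hidle : ∀ k ∈ X, ∀ z, evalBool g' (flipBit k z) = evalBool g' z := by
    intro k hk z
    rw [hXdef, Finset.mem_map] at hk
    obtain ⟨i, -, rfl⟩ := hk
    show evalBool (rename (Fin.natAdd n₁) g) (flipBit (Fin.castAdd N i) z) = evalBool (rename (Fin.natAdd n₁) g) z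
    rw [evalBool_rename_natAdd, evalBool_rename_natAdd, flipBit_castAdd_comp_natAdd]
  have hdeg : g'.totalDegree ≤ T := (totalDegree_rename_le _ _).trans hg
  have hg1' : ∀ z, evalBool g' z ^ 2 ≤ 1 := fun z => by
    show evalBool (rename (Fin.natAdd n₁) g) z ^ 2 ≤ 1
    rw [evalBool_rename_natAdd]; exact hg1 _
  have hF : ∀ (S' : Finset (Fin (n₁ + N))) (i : Fin n₁), Fin.castAdd N i ∈ S' →
      cubeFourierCoeff (evalBool g') S' ^ 2 = 0 := by
    intro S' i hi
    show cubeFourierCoeff (evalBool (rename (Fin.natAdd n₁) g)) S' ^ 2 = 0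
    rw [cubeFourierCoeff_pad_eq_zero g hi, sq, mul_zero]
  have hcoef : ∀ S : Finset (Fin N), cubeFourierCoeff (evalBool g') (S.map (Fin.natAddEmb n₁)) = a S := fun S => by
    show cubeFourierCoeff (evalBool (rename (Fin.natAdd n₁) g)) (S.map (Fin.natAddEmb n₁)) = cubeFourierCoeff (evalBool g) S
    exact cubeFourierCoeff_pad_map g S
  -- transport of the top weight
  have hW' : ∑ S' ∈ Finset.univ.filter (fun S' : Finset (Fin (n₁ + N)) => S'.card = T),
      cubeFourierCoeff (evalBool g') S' ^ 2 = W := by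
    rw [sum_pad_eq (fun S' => cubeFourierCoeff (evalBool g') S' ^ 2) hF (fun S' => S'.card = T)]
    simp_rw [Finset.card_map, hcoef]
    rfl
  -- transport of the row weights
  have hrow' : ∀ k' : Fin (n₁ + N),
      ∑ S' ∈ Finset.univ.filter (fun S' : Finset (Fin (n₁ + N)) => S'.card = T ∧ k' ∈ S'),
        cubeFourierCoeff (evalBool g') S' ^ 2 ≤ μ := by
    intro k'
    rw [sum_pad_eq (fun S' => cubeFourierCoeff (evalBool g') S' ^ 2) hF (fun S' => S'.card = T ∧ k' ∈ S')]
    simp_rw [Finset.card_map, hcoef]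
    rcases castAdd_or_natAdd k' with ⟨i, rfl⟩ | ⟨j, rfl⟩
    · -- a padding coordinate lies in no embedded live set
      have hempty : ∀ S : Finset (Fin N), ¬ (S.card = T ∧ Fin.castAdd N i ∈ S.map (Fin.natAddEmb n₁)) := by
        rintro S ⟨-, hS⟩
        rw [Finset.mem_map] at hS
        obtain ⟨j, -, hj⟩ := hS
        change Fin.natAdd n₁ j = Fin.castAdd N i at hj
        have hv := congrArg Fin.val hj
        simp only [Fin.val_natAdd, Fin.val_castAdd] at hv
        omega
      rw [Finset.filter_false_of_mem (fun S _ => hempty S), Finset.sum_empty]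
      exact hμpos.le
    · have hmem : ∀ S : Finset (Fin N), (Fin.natAdd n₁ j ∈ S.map (Fin.natAddEmb n₁) ↔ j ∈ S) := fun S =>
        Finset.mem_map' (Fin.natAddEmb n₁)
      simp_rw [hmem]
      exact hk₁ j (Finset.mem_univ _)
  have hmain := topWeight_sq_le_rowWeight_of_uniformContraction K h hT g' hdeg hg1' X hidle
    (by rw [hXcard]; exact hn₁T) μ hrow' (by rw [hW', hXcard]; exact hn₁)
  rw [hW'] at hmain
  exact hmain

/-- **Top-level AA with constant `K(T)` for ALL bounded polynomials, influence form**: under the uniform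
contraction bound, every `g` of total degree `≤ T` (`T ≥ 1`) with `g² ≤ 1` on the cube and `W^{=T}[g] > 0` has a
variable with `4·(W^{=T}[g])² ≤ K T · Inf_k[g]` (`Inf_k = 4 Σ_{S∋k} ĝ(S)² ≥ 4 Σ_{|S|=T, S∋k} ĝ(S)²`).  For
homogeneous `g` (`Var = W^{=T}`) this is the Aaronson–Ambainis conjecture on that class with constant `4/K(T)`.
[cite: AaronsonAmbainis2014, Conj. 6] [cite: ODonnellZhao2016, Remark 2.14] -/
theorem exists_influence_ge_topWeight_sq_of_uniformContraction (K : ℕ → ℝ)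
    (h : ∀ (N T m : ℕ) (q : Fin m → MvPolynomial (Fin N) ℝ) (p : MvPolynomial (Fin N) ℝ), 1 ≤ T →
      (∀ j, (q j).totalDegree ≤ T) → (∀ x, evalBool p x = ∑ j, evalBool (q j) x ^ 2) →
      (∀ x, evalBool p x ≤ 1) →
      ∀ (c : Finset (Fin N) → ℝ) (M : ℝ),
        (∀ k : Fin N, ∑ U ∈ Finset.univ.filter (fun U : Finset (Fin N) => U.card = 2 * T ∧ k ∈ U), c U ^ 2 ≤ M) →
        ∑ j, ∑ R ∈ Finset.univ.filter (fun R : Finset (Fin N) => R.card = T),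
          (∑ U ∈ Finset.univ.filter (fun U : Finset (Fin N) => U.card = 2 * T ∧ R ⊆ U),
            c U * cubeFourierCoeff (evalBool (q j)) (U \ R)) ^ 2 ≤ K T * M)
    (hK0 : ∀ T, 0 ≤ K T)
    {N T : ℕ} (hT : 1 ≤ T) (g : MvPolynomial (Fin N) ℝ) (hg : g.totalDegree ≤ T)
    (hg1 : ∀ x, evalBool g x ^ 2 ≤ 1)
    (hW : 0 < ∑ S ∈ Finset.univ.filter (fun S : Finset (Fin N) => S.card = T), cubeFourierCoeff (evalBool g) S ^ 2) :
    ∃ k : Fin N, 4 * (∑ S ∈ Finset.univ.filter (fun S : Finset (Fin N) => S.card = T),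
        cubeFourierCoeff (evalBool g) S ^ 2) ^ 2 ≤ K T * influence k g := by
  classical
  obtain ⟨k, hk⟩ := exists_topRow_ge_of_uniformContraction K h hT g hg hg1 hW
  refine ⟨k, ?_⟩
  rw [influence_eq_sum_sq_fourier]
  have hsub : ∑ S ∈ Finset.univ.filter (fun S : Finset (Fin N) => S.card = T ∧ k ∈ S),
      cubeFourierCoeff (evalBool g) S ^ 2 ≤
      ∑ S ∈ Finset.univ.filter (fun S : Finset (Fin N) => k ∈ S), cubeFourierCoeff (evalBool g) S ^ 2 :=
    Finset.sum_le_sum_of_subset_of_nonneg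
      (fun S hS => by
        rw [Finset.mem_filter] at hS ⊢
        exact ⟨hS.1, hS.2.2⟩)
      fun S _ _ => sq_nonneg _
  calc 4 * (∑ S ∈ Finset.univ.filter (fun S : Finset (Fin N) => S.card = T),
          cubeFourierCoeff (evalBool g) S ^ 2) ^ 2
      ≤ 4 * (K T * ∑ S ∈ Finset.univ.filter (fun S : Finset (Fin N) => S.card = T ∧ k ∈ S),
          cubeFourierCoeff (evalBool g) S ^ 2) := by linarith
    _ ≤ 4 * (K T * ∑ S ∈ Finset.univ.filter (fun S : Finset (Fin N) => k ∈ S),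
          cubeFourierCoeff (evalBool g) S ^ 2) :=
        mul_le_mul_of_nonneg_left (mul_le_mul_of_nonneg_left hsub (hK0 T)) (by norm_num)
    _ = K T * (4 * ∑ S ∈ Finset.univ.filter (fun S : Finset (Fin N) => k ∈ S),
          cubeFourierCoeff (evalBool g) S ^ 2) := by ring

end TopPairing

end Summit.QuantumAdvantage.QuantumAdvantage.Theorems.SosSandwich

end
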